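import Summits.BirchSwinnertonDyer.BirchSwinnertonDyer.Theorems.Rank2ObservatoryTamagawaKernelCert
import Literature.NumberTheory.EllipticCurves.GlobalMinimalModel
import HarnessLib

/-!
# The Tamagawa product `∏ c_ℓ` of a curve given by its INTEGRAL MODEL, from the rank-2 observatory's
# kernel row certificates (`TamLocal` / `TamX` / `TamZ`) — bridge lemmas for the per-pair records of
# team n1011 (cell `b2b-bsdres`, seat p03, OWNERS row T-a2-REC; kernel TOOL, data-free)

HONEST FRAMING (cell `b2b-bsdres`, run/shared/lean/b2b/bsd-rank1-residual/, verbatim in every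
file): the goal of the cell is to DELETE the COMBINATION-SHAPED residual classes of the
Birch–Swinnerton-Dyer formula for ALL analytic-rank `≤ 1` elliptic curves over `ℚ` — "full BSD
formula for every rank `≤ 1` curve in class `C`" assembled STRICTLY from published theorems — so
that the rank-`≤ 1` remainder becomes exactly the CONSTRUCTION-SHAPED classes, which are TYPED
(missing-input `Prop`s), NOT attempted. This is not "finishing BSD". Team n1011 is a RESEARCH ROUTE;
no claim beyond the stated classes; nothing is booked by this file. Theorems only (no definition, no
named fact, no axiom).

## What this file does

The per-pair record shapes of `Additive/X4ThreeKuriharaCertKernel*.lean` carry the Tamagawa binder of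
the row as a HYPOTHESIS read off Cremona's table: `htam : ¬ 3 ∣ ∏ c_ℓ` on LOWER/unit rows,
`1 ≤ ord₃ ∏ c_ℓ` and the level `k ≤ ord₃ ∏ c_ℓ + 1` on Tamagawa-DEFECT rows. The rank-2 observatory
(`b2b-bsdr2`, cert-2) landed a KERNEL certificate format for `∏_v c_v` of an integer equation
(`Rank2ObservatoryTamagawaLocal/Cert/ExactCert/KernelCert`: Tate's algorithm as `decide`-able
certificates, ONE soundness theorem per stage, NO named fact): stage 1 `TamLocal` brackets `c_p`
(exact at multiplicative / `II` / `III` / `III*` / `II*` primes), stage 2 `TamX` makes `IV` / `IV*` exact,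
stage 3 `TamZ` makes `I₀*` / `Iₙ*` exact. Those theorems speak about `(W₀.baseChange ℚ).tamagawaProduct`
for `W₀ : WeierstrassCurve ℤ`; the records speak about `W.tamagawaProduct` for a globally minimal `W / ℚ`
with `integralModelInt W = W₀` (or a literal `W = [a₁,…,a₆]`). This file is the bridge:
* `baseChange_rat_mk_int`, `eq_baseChange_of_integralModelInt` (`W = W₀ ⊗ ℚ`);
* `tamagawaProduct_mem_rowVals_of_intModel` (stage 1: `∏ c_ℓ ∈ rowVals Es`),
  `tamagawaProduct_eq_rowValueX_of_intModel` (stage 2 exact), `tamagawaProduct_eq_rowValueZ_of_intModel`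
  (stage 3 exact) — each from ONE `decide`-able row check on `W₀`;
* the two consumers the records need: `not_dvd_tamagawaProduct_of_intModel_of_rowCheck` (`p ∤ ∏ c_ℓ`
  from a stage-1 bracket all of whose values are prime to `p` — a Boolean side condition) and
  `padicValNat_tamagawaProduct_of_intModel_of_rowCheckZ` (`ord_p ∏ c_ℓ` as a kernel numeral).
So the `htam` / `ord₃ ∏ c_ℓ` binders of the T-a2-REC records become kernel certificates (sequel
`X4ThreeKuriharaCertRecords1Tamagawa`); the certificates are emitted by the observatory's engine 1
(`kernel-tam3/engine1/tam.py`, `tamx.py`, `tamz.py`, reused unchanged) and checked by `decide +kernel`.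

References: J. Tate, "Algorithm for determining the type of a singular fiber in an elliptic pencil", LNM 476
(1975) §7 [Tate1975]; J. H. Silverman, *Advanced Topics in the Arithmetic of Elliptic Curves*, GTM 151 (1994),
IV.9.4 [Silverman1994]; J. H. Silverman, *The Arithmetic of Elliptic Curves*, 2nd ed. (2009), VII.1, VIII.8
[SilvermanAEC2009]; J. E. Cremona, *Algorithms for Modular Elliptic Curves* (1997) §3.2 [CremonaAlgorithms1997].
-/

set_option autoImplicit false

open WeierstrassCurve
open Summit.BirchSwinnertonDyer.BirchSwinnertonDyer.Rank2Observatory.Tam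

namespace Summit.BirchSwinnertonDyer.Rank1Residual.Additive.IntModelTam

/-! ### The bridge `W = W₀ ⊗ ℚ` -/

/-- A literal integer equation base-changes to the literal rational one. [folklore] -/
theorem baseChange_rat_mk_int (a1 a2 a3 a4 a6 : ℤ) :
    (⟨a1, a2, a3, a4, a6⟩ : WeierstrassCurve ℤ).baseChange ℚ = (⟨a1, a2, a3, a4, a6⟩ : WeierstrassCurve ℚ) := by
  ext <;> simp [baseChange, WeierstrassCurve.map]

/-- A globally minimal `W / ℚ` IS the base change of its integral model (uniqueness of the lift along
`ℤ ↪ ℚ`, `map_integralModelInt`). [cite: SilvermanAEC2009, VIII.8 (minimal equations over `ℤ`)] -/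
theorem eq_baseChange_of_integralModelInt {W : WeierstrassCurve ℚ} [W.IsGloballyMinimal]
    {W₀ : WeierstrassCurve ℤ} (hI : integralModelInt W = W₀) : W = W₀.baseChange ℚ := by
  have h := map_integralModelInt W
  rw [hI] at h
  rw [← h]
  ext <;> simp [baseChange, WeierstrassCurve.map]

/-! ### The Tamagawa product from a row certificate on the integral model -/

section

variable {W : WeierstrassCurve ℚ} [W.IsGloballyMinimal] {W₀ : WeierstrassCurve ℤ}
  {Es : List TamLocal} {Xs : List TamX} {Zs : List TamZ}

/-- **Stage 1 (bracket)**: if the `TamLocal` row certificate `Es` checks on the integral model `W₀` of a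
globally minimal `W / ℚ`, then `∏_ℓ c_ℓ(W) ∈ rowVals Es` (every bad prime listed — `|Δ| = ∏ pⁿ` —, each
`c_p` in its certified set; exact at multiplicative, `II`, `III`, `III*`, `II*` primes).
[cite: Silverman1994, IV.9.4] [cite: SilvermanAEC2009, VII.1 Remark 1.1] -/
theorem tamagawaProduct_mem_rowVals_of_intModel (hI : integralModelInt W = W₀)
    (h : TamLocal.rowCheck Es W₀ = true) : W.tamagawaProduct ∈ TamLocal.rowVals Es := by
  have hGM : (W₀.baseChange ℚ).IsGloballyMinimal := eq_baseChange_of_integralModelInt hI ▸ ‹_›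
  rw [eq_baseChange_of_integralModelInt hI]
  exact TamLocal.tamagawaProduct_mem h hGM

/-- **Stage 2 (exact at `IV` / `IV*`)**: if the sharpened row certificate `(Es, Xs)` checks on `W₀` and
every sharpened local set is a singleton, `∏_ℓ c_ℓ(W) = rowValueX Es Xs`.
[cite: Silverman1994, IV.9.4 Steps 5, 8] -/
theorem tamagawaProduct_eq_rowValueX_of_intModel (hI : integralModelInt W = W₀)
    (h : TamX.rowCheckX Es Xs W₀ = true) (hx : TamX.rowExactX Es Xs = true) :
    W.tamagawaProduct = TamX.rowValueX Es Xs := by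
  have hGM : (W₀.baseChange ℚ).IsGloballyMinimal := eq_baseChange_of_integralModelInt hI ▸ ‹_›
  rw [eq_baseChange_of_integralModelInt hI]
  exact TamX.tamagawaProduct_eqX h hGM hx

/-- **Stage 3 (exact at `I₀*` / `Iₙ*` too)**: if the kernel-sharpened row certificate `(Es, Xs, Zs)` checks
on `W₀` and every sharpened local set is a singleton, `∏_ℓ c_ℓ(W) = rowValueZ Es Xs Zs` — a kernel
numeral. [cite: Tate1975, §7] [cite: Silverman1994, IV.9.4 Steps 6–7] -/
theorem tamagawaProduct_eq_rowValueZ_of_intModel (hI : integralModelInt W = W₀)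
    (h : TamZ.rowCheckZ Es Xs Zs W₀ = true) (hx : TamZ.rowExactZ Es Xs Zs = true) :
    W.tamagawaProduct = TamZ.rowValueZ Es Xs Zs := by
  have hGM : (W₀.baseChange ℚ).IsGloballyMinimal := eq_baseChange_of_integralModelInt hI ▸ ‹_›
  rw [eq_baseChange_of_integralModelInt hI]
  exact TamZ.tamagawaProduct_eqZ h hGM hx

/-! ### The two consumers of the T-a2-REC records -/

/-- **`p ∤ ∏ c_ℓ` from a stage-1 bracket**: if the row certificate checks and NO value of the certified
set `rowVals Es` is divisible by `p` (a Boolean, `decide`), then `p ∤ ∏_ℓ c_ℓ(W)` — the `htam` binder of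
the LOWER/unit-row records as a kernel certificate (no exactness needed: e.g. `{1,2,4}·{1}·{1}·{2}` at
`p = 3`). [cite: Silverman1994, IV.9.4] -/
theorem not_dvd_tamagawaProduct_of_intModel_of_rowCheck (hI : integralModelInt W = W₀)
    (h : TamLocal.rowCheck Es W₀ = true) (p : ℕ)
    (hp : (TamLocal.rowVals Es).all (fun c => !decide (p ∣ c)) = true) : ¬ p ∣ W.tamagawaProduct := by
  have hm := tamagawaProduct_mem_rowVals_of_intModel hI h
  simpa using List.all_eq_true.mp hp _ hm

/-- **`ord_p ∏ c_ℓ` as a kernel numeral** (stage 3 exact rows): `ord_p ∏_ℓ c_ℓ(W) = ord_p (rowValueZ Es Xs Zs)`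
— the Tamagawa-DEFECT binders `1 ≤ ord₃ ∏ c_ℓ` and the level `k ≤ ord₃ ∏ c_ℓ + 1` of the defect-row
records as kernel certificates. [cite: Tate1975, §7] [cite: Silverman1994, IV.9.4 Steps 6–7] -/
theorem padicValNat_tamagawaProduct_of_intModel_of_rowCheckZ (hI : integralModelInt W = W₀)
    (h : TamZ.rowCheckZ Es Xs Zs W₀ = true) (hx : TamZ.rowExactZ Es Xs Zs = true) (p : ℕ) :
    padicValNat p W.tamagawaProduct = padicValNat p (TamZ.rowValueZ Es Xs Zs) := by
  rw [tamagawaProduct_eq_rowValueZ_of_intModel hI h hx]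

/-- **`p ∤ ∏ c_ℓ`, exact form** (stage 3): from the kernel-sharpened row certificate and `p ∤ rowValueZ`.
[cite: Tate1975, §7] [cite: Silverman1994, IV.9.4 Steps 6–7] -/
theorem not_dvd_tamagawaProduct_of_intModel_of_rowCheckZ (hI : integralModelInt W = W₀)
    (h : TamZ.rowCheckZ Es Xs Zs W₀ = true) (hx : TamZ.rowExactZ Es Xs Zs = true) {p : ℕ}
    (hp : ¬ p ∣ TamZ.rowValueZ Es Xs Zs) : ¬ p ∣ W.tamagawaProduct := by
  rwa [tamagawaProduct_eq_rowValueZ_of_intModel hI h hx]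

end

/-! ### Kernel self-test on a cell row: Cremona's `19215t1` (N11 LOWER@3, T-a2-REC record 1) -/

/-- Row certificate of `19215t1 = [0, 0, 1, -10107597, -12660392115]` (`Δ = −3⁶·5·7¹⁷·61²`): `3` of type
`I₀*` (deep Tate certificate, Step-6 form after `(r, s, t) = (2, 0, 4)`; Tate's cubic has NO residue root:
`c₃ = 1` by the kernel certificate `TamZ` kind `9`, `w = 0`), `5` of type `I₁` split (`c₅ = 1`), `7` of type
`I₁₇` non-split by the Euler witness (`c₇ = 1`), `61` of type `I₂` split (`c₆₁ = 2`) — the stage-1 bracket is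
`{1,2,4}·{1}·{1}·{2}`, the kernel value `∏ c_ℓ = 2`; engine 1 = the observatory's `tam.py`/`tamz.py`
(Cremona's table: `∏ c_ℓ = 2`). [cite: Silverman1994, IV.9.4] [cite: CremonaAlgorithms1997, Table 1] -/
theorem rowCheckZ_v19215t1 :
    TamZ.rowCheckZ [⟨3, 1, 5, 0, 2, 0, 4, 6, 6, 0, 1⟩, ⟨5, 2, 1, 3, 0, 0, 0, 1, 0, 0, 1⟩,
        ⟨7, 2, 3, 0, 0, 0, 0, 17, 0, 0, 1⟩, ⟨61, 7, 1, 10, 0, 0, 0, 2, 0, 0, 2⟩] []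
      [⟨3, 9, 2, 0, 4, 6, 0, 0⟩] ⟨0, 0, 1, -10107597, -12660392115⟩ = true := by
  decide +kernel

/-- **`∏_ℓ c_ℓ (19215t1) = 2` IN THE KERNEL** for any globally minimal `W / ℚ` with integral model
`[0, 0, 1, -10107597, -12660392115]` (so `3 ∤ ∏ c_ℓ`: the `htam` binder of record `bsdp3_kur_v19215t1`
discharged). [cite: Silverman1994, IV.9.4] [cite: CremonaAlgorithms1997, Table 1] -/
theorem tamagawaProduct_v19215t1 {W : WeierstrassCurve ℚ} [W.IsGloballyMinimal]
    (hI : integralModelInt W = ⟨0, 0, 1, -10107597, -12660392115⟩) : W.tamagawaProduct = 2 :=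
  (tamagawaProduct_eq_rowValueZ_of_intModel hI rowCheckZ_v19215t1 (by decide +kernel)).trans
    (by decide +kernel)

end Summit.BirchSwinnertonDyer.Rank1Residual.Additive.IntModelTam
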